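import Summits.NavierStokesRegularity.NavierStokesRegularity.Theorems.ScenarioCensusRowF1ax
import Summits.NavierStokesRegularity.NavierStokesRegularity.Theorems.ScenarioCensusRowA7h
import Summits.NavierStokesRegularity.NavierStokesRegularity.Theorems.DssFarFieldSlavingBlowupTypeIDssProfileSimilarityEnstrophyBeltramiLiouville
import Summits.NavierStokesRegularity.NavierStokesRegularity.Theorems.SqueezeCycleSingularZoomWindow
import Summits.NavierStokesRegularity.NavierStokesRegularity.Theorems.ClockStretchingLawClockCeilingZoomDerivLimit
import Summits.NavierStokesRegularity.NavierStokesRegularity.Theorems.PoloidalWindowDoorPoloidalWindowRigidityVorticityTranslate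
import Literature.Analysis.FluidPDE.HarmonicLiouvilleLp
import Literature.Analysis.FluidPDE.BoundedAnnihilator
import Literature.Analysis.FluidPDE.TypeIAncientMild
import Literature.Analysis.FluidPDE.AncientMildWeak
import Literature.Analysis.FluidPDE.AncientMildWeakStar
import Literature.Analysis.FluidPDE.DivCurlAnnihilator
import Literature.Analysis.FluidPDE.WholeSpaceIBP
import Literature.Analysis.FluidPDE.ClassicalSolutionCalculus
import Literature.Analysis.FluidPDE.LambFormCurlKernel
import Literature.Analysis.FluidPDE.BiotSavartCurlPair
import HarnessLib
import Summits.NavierStokesRegularity.NavierStokesRegularity.Theorems.ScenarioCensusRowF1FrozenTop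

/-!
# Census row F1, family «DYNAMIC TOP» (F1eqq / F1bnq; o-forms F1eq / F1bn) — LINE «equilibrium-top» port, part 1/4: levels, the dimensionless Type-I constant, the two
# dynamic defects (drive / head) and their kinematic forms (§1); second-order calculus of zooms and the `C²_loc` tool (§2; shared lemmas BY NAME from the inviscid-top port)

Re-homed for the scenario census (typer seat ns-census-typer-1 g8; the cells F1eqq / F1bnq and the o-forms F1eq / F1bn are MEMBERS OF RECORD «DECIDED IN KERNEL IN FILES» of
row F1 since census v1.71 (critic idea-crit-3 PASS; ref ns-census-ref g8 PRE-CHECK ✓; lead-presearch label); this port makes them TREE-decided): VERBATIM PORT of ns-idea-3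
LINE 19 «equilibrium-top», `pub/ideators/ns-idea-3/lines/equilibrium-top/line-equilibrium-top.lean` sha16 a530d660993acd54 (1664 l., lean check rc 0, 0 sorry), split
for the 400-line rule into `ScenarioCensusRowF1Equilibrium` (§1–§2) → `…EquilibriumKill` (§3–§5) → `…EquilibriumTransfer` (§6) → `…EquilibriumTop` (§7 + census KEYS).
Lean text VERBATIM in namespace `…Theorems.ScenarioCensus.EquilibriumTop` (the line's `…Cruxes.ScenarioCensusRowF1.EquilibriumTopLine` re-homed); port edits:
`@[conjecture]` on the residual `DriveDefectSlack` (≡ `ScenarioCensus.Row_F1`, OPEN), one-line docstrings added where missing (gate lint); the lemmas the line shares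
VERBATIM with the landed inviscid-top / frozen-top / columnar-top / stretched-top ports — including the §4 weak time-rigidity chain `cp` … `eq_zero_of_frozenVorticity`,
which the frozen-top port carries verbatim (and with it the one use of `Literature.Analysis.FunctionSpaces.WeakTimeDerivativeClassical`) — are taken BY NAME (listed
below); the line's direct WTDC import is therefore not needed here.  Statements untouched.

No census VALUE is moved here (row F1 stays OPEN-WITH-LINE; the members become TREE-decided by name); NS regularity is NOT proved; `Row_F1` is untouched
(zero movement, `driveDefectSlack_iff_rowF1`); no summit statement is proved by this file. Lemmas that restate already-landed tree declarations are taken BY NAME (gate lint `dedup.landed`): `fderiv_smul_stPull_apply` = `InviscidTop.fderiv_smul_stPull_apply`, `fderiv_smul_stPull` = `InviscidTop.fderiv_smul_stPull`, `fderiv_fderiv_smul_stPull` = `InviscidTop.fderiv_fderiv_smul_stPull`, `fderiv_fderiv_zoom` = `InviscidTop.fderiv_fderiv_zoom`, `tendsto_clm_of_tendsto_apply` = `InviscidTop.tendsto_clm_of_tendsto_apply`, `tendsto_fderiv_fderiv_apply_of_bound` = `InviscidTop.tendsto_fderiv_fderiv_apply_of_bound`, `tendsto_fderiv_fderiv_of_bound`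 = `InviscidTop.tendsto_fderiv_fderiv_of_bound`, `tendsto_fderiv_fderiv_of_typeI_seq_Ioo` = `InviscidTop.tendsto_fderiv_fderiv_of_typeI_seq_Ioo`, `tendsto_fderiv_fderiv_of_isTypeIAncientMild_seq` = `InviscidTop.tendsto_fderiv_fderiv_of_isTypeIAncientMild_seq`, `cp` = `FrozenTop.cp`, `cp_isTest` = `FrozenTop.cp_isTest`, `cp_isDivFree` = `FrozenTop.cp_isDivFree`, `pairing_eq_of_weakEquilibrium` = `FrozenTop.pairing_eq_of_weakEquilibrium`, `slice_sub_const_of_pairing_eq` = `FrozenTop.slice_sub_const_of_pairing_eq`, `eq_zero_of_increments_const` = `FrozenTop.eq_zero_of_increments_const`, `eq_zero_of_weakEquilibrium` = `FrozenTop.eq_zero_of_weakEquilibrium`, `eq_zero_of_frozenVorticity` = `FrozenTop.eq_zero_of_frozenVorticity`, `tendsto_physicalTime` = `ColumnarTop.tendsto_physicalTime`, `eventually_fast` = `ColumnarTop.eventually_fast`, `sqrt_timeLag` = `StretchedTop.sqrt_timeLag`, `forall_of_forall_ne_zero` = `StretchedTop.forall_of_forall_ne_zero`, `radius_eq` = `FrozenTop.radius_eq`,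 `sing_of_not_bounded` = `InviscidTop.sing_of_not_bounded`.
-/

-- the summit and its single problem share the name `NavierStokesRegularity` (D-0017 nested layout)
set_option linter.dupNamespace false

noncomputable section

open MeasureTheory Set Function Filter TopologicalSpace Metric
open scoped Topology NNReal ENNReal InnerProductSpace RealInnerProductSpace Laplacian

namespace Summit.NavierStokesRegularity.NavierStokesRegularity.Theorems.ScenarioCensus.EquilibriumTop

open Literature.Analysis Literature.Analysis.FluidPDE
open Summit.NavierStokesRegularity.NavierStokesRegularity.Theorems

/-- `ℝ³`. -/
abbrev E3 := EuclideanSpace ℝ (Fin 3)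

/-- The space of Hessians `D²v(x) : ℝ³ →L (ℝ³ →L ℝ³)`. -/
abbrev Hess := E3 →L[ℝ] E3 →L[ℝ] E3

/-! ## §1 Levels, the dimensionless Type-I constant, the two dynamic defects and their kinematic forms -/

/-- **Subcritical (moving) speed level**: `Λ(t) √(T − t) → 0` as `t ↑ T`. -/
def IsSubcriticalLevel (T : ℝ) (Λ : ℝ → ℝ) : Prop :=
  Tendsto (fun t => Λ t * Real.sqrt (T - t)) (𝓝[<] T) (𝓝 0)

/-- **Type-I blow-up with dimensionless constant `M`**: eventually `√(T − t) ‖u(t, x)‖ ≤ M √ν`. -/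
def IsTypeIBlowupWith (M ν : ℝ) (u : ℝ → E3 → E3) (T : ℝ) : Prop :=
  ∀ᶠ t in 𝓝[<] T, ∀ x : E3, Real.sqrt (T - t) * ‖u t x‖ ≤ M * Real.sqrt ν

/-- The second-order clock weight `√ν (T − t)^{3/2}` (as in LINE 18); the DRIVE weight is `clock₂/ν = (T−t)^{3/2}/√ν`. -/
def clock₂ (ν T t : ℝ) : ℝ := Real.sqrt ν * ((T - t) * Real.sqrt (T - t))

/-- **ε-EQUILIBRIUM TOP** (Eulerian drive defect, DYNAMIC form): eventually, at every `Λ t`-fast point,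
`(T − t)^{3/2} ν^{-1/2} ‖∂ₜu(t, x) + ∇p(t, x)‖ ≤ ε` — the local acceleration is balanced by the pressure force up to
`ε √ν (T − t)^{-3/2}`, an `ε/M`-fraction of the Type-I inertial scale (`∂ₜ` within `[0, T)`, the convention of
`IsClassicalNSSolutionOn (Ico 0 T)`). -/
def HasDriveDefectAt (T : ℝ) (Λ : ℝ → ℝ) (ν ε : ℝ) (u : ℝ → E3 → E3) (p : ℝ → E3 → ℝ) : Prop :=
  ∀ᶠ t in 𝓝[<] T, ∀ x : E3, Λ t < ‖u t x‖ →
    clock₂ ν T t / ν * ‖timeDerivWithin (Ico 0 T) u t x + gradient (p t) x‖ ≤ ε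

/-- **ε-BERNOULLI TOP** (head drive defect, DYNAMIC form): eventually, at every fast point,
`(T − t)^{3/2} ν^{-1/2} ‖∂ₜu + ∇(p + |u|²/2)‖ ≤ ε`. -/
def HasHeadDefectAt (T : ℝ) (Λ : ℝ → ℝ) (ν ε : ℝ) (u : ℝ → E3 → E3) (p : ℝ → E3 → ℝ) : Prop :=
  ∀ᶠ t in 𝓝[<] T, ∀ x : E3, Λ t < ‖u t x‖ →
    clock₂ ν T t / ν *
      ‖timeDerivWithin (Ico 0 T) u t x + gradient (p t) x + gradient (fun y => ‖u t y‖ ^ 2 / 2) x‖ ≤ ε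

/-- Kinematic form of the drive defect: `(T − t)^{3/2} ν^{-1/2} ‖ν Δu − (u·∇)u‖ ≤ ε` at the fast points. -/
def HasEquilibriumDefectAt (T : ℝ) (Λ : ℝ → ℝ) (ν ε : ℝ) (u : ℝ → E3 → E3) : Prop :=
  ∀ᶠ t in 𝓝[<] T, ∀ x : E3, Λ t < ‖u t x‖ →
    clock₂ ν T t / ν * ‖ν • (Δ (u t)) x - convect (u t) (u t) x‖ ≤ ε

/-- Kinematic form of the head defect: `(T − t)^{3/2} ν^{-1/2} ‖ν Δu − ω × u‖ ≤ ε` at the fast points. -/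
def HasLambDefectAt (T : ℝ) (Λ : ℝ → ℝ) (ν ε : ℝ) (u : ℝ → E3 → E3) : Prop :=
  ∀ᶠ t in 𝓝[<] T, ∀ x : E3, Λ t < ‖u t x‖ →
    clock₂ ν T t / ν * ‖ν • (Δ (u t)) x - cross (curl (u t) x) (u t x)‖ ≤ ε

/-- **Generic joint defect** of a read-out `Rd(v, L, H)` of (value, gradient, Hessian), `ν`-normalised:
`ν · clock₂ · Rd(u/ν, ∇u/ν, ∇²u/ν) ≤ ε` at the fast points, eventually. -/
def HasJointDefectAt (T : ℝ) (Λ : ℝ → ℝ) (ν ε : ℝ) (Rd : E3 → (E3 →L[ℝ] E3) → Hess → ℝ)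
    (u : ℝ → E3 → E3) : Prop :=
  ∀ᶠ t in 𝓝[<] T, ∀ x : E3, Λ t < ‖u t x‖ →
    ν * clock₂ ν T t * Rd (ν⁻¹ • u t x) (ν⁻¹ • fderiv ℝ (u t) x) (ν⁻¹ • fderiv ℝ (fderiv ℝ (u t)) x) ≤ ε

/-- Constant levels are subcritical. -/
theorem isSubcriticalLevel_const (T Λ : ℝ) : IsSubcriticalLevel T (fun _ => Λ) := by
  have h : Tendsto (fun t : ℝ => Λ * Real.sqrt (T - t)) (𝓝 T) (𝓝 (Λ * Real.sqrt (T - T))) :=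
    ((continuous_const.sub continuous_id).sqrt.tendsto T).const_mul Λ
  rw [sub_self, Real.sqrt_zero, mul_zero] at h
  exact h.mono_left nhdsWithin_le_nhds

/-- The second-order clock is non-negative. -/
theorem clock₂_nonneg (ν T t : ℝ) : 0 ≤ clock₂ ν T t := by
  unfold clock₂
  by_cases h : 0 ≤ T - t
  · positivity
  · push Not at h
    rw [Real.sqrt_eq_zero'.2 h.le, mul_zero, mul_zero]

/-- Monotonicity of the defects in `ε`. -/
theorem HasDriveDefectAt.mono {T ν : ℝ} {Λ : ℝ → ℝ} {ε ε' : ℝ} {u : ℝ → E3 → E3} {p : ℝ → E3 → ℝ}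
    (h : HasDriveDefectAt T Λ ν ε u p) (hε : ε ≤ ε') : HasDriveDefectAt T Λ ν ε' u p :=
  Filter.Eventually.mono h fun _ ht x hx => (ht x hx).trans hε

/-- Monotonicity of the head defect in `ε`. -/
theorem HasHeadDefectAt.mono {T ν : ℝ} {Λ : ℝ → ℝ} {ε ε' : ℝ} {u : ℝ → E3 → E3} {p : ℝ → E3 → ℝ}
    (h : HasHeadDefectAt T Λ ν ε u p) (hε : ε ≤ ε') : HasHeadDefectAt T Λ ν ε' u p :=
  Filter.Eventually.mono h fun _ ht x hx => (ht x hx).trans hε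

/-- A dimensionless Type-I bound is a Type-I bound. -/
theorem IsTypeIBlowupWith.isTypeIBlowup {M ν T : ℝ} {u : ℝ → E3 → E3} (h : IsTypeIBlowupWith M ν u T) :
    IsTypeIBlowup u T := by
  refine ⟨M * Real.sqrt ν, ?_⟩
  filter_upwards [h, self_mem_nhdsWithin] with t ht htT x
  have htT' : t < T := htT
  have hs : 0 < Real.sqrt (T - t) := Real.sqrt_pos.2 (sub_pos.2 htT')
  rw [le_div_iff₀ hs, mul_comm]
  exact ht x

/-- Every Type-I blow-up has a dimensionless constant (`M = C/√ν`). -/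
theorem exists_isTypeIBlowupWith {ν T : ℝ} (hν : 0 < ν) {u : ℝ → E3 → E3} (h : IsTypeIBlowup u T) :
    ∃ M : ℝ, IsTypeIBlowupWith M ν u T := by
  obtain ⟨C, hC⟩ := h
  refine ⟨C / Real.sqrt ν, ?_⟩
  have hsν : 0 < Real.sqrt ν := Real.sqrt_pos.2 hν
  filter_upwards [hC, self_mem_nhdsWithin] with t ht htT x
  have htT' : t < T := htT
  have hs : 0 < Real.sqrt (T - t) := Real.sqrt_pos.2 (sub_pos.2 htT')
  rw [div_mul_cancel₀ C hsν.ne']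
  have h1 := ht x
  rw [le_div_iff₀ hs] at h1
  rw [mul_comm]
  exact h1

/-! ### The momentum dictionary: dynamic = kinematic for classical solutions -/

/-- `ν Δu − (u·∇)u = ∂ₜu + ∇p` on `[0, T)` (the momentum equation of `IsClassicalNSSolutionOn (Ico 0 T) ν 0`). -/
theorem drive_eq {ν T : ℝ} {u : ℝ → E3 → E3} {p : ℝ → E3 → ℝ} (hsol : IsClassicalNSSolutionOn (Ico 0 T) ν 0 u p)
    {t : ℝ} (ht : t ∈ Ico 0 T) (x : E3) :
    ν • (Δ (u t)) x - convect (u t) (u t) x = timeDerivWithin (Ico 0 T) u t x + gradient (p t) x := by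
  have h := hsol.momentum t ht x
  rw [Pi.zero_apply, Pi.zero_apply, add_zero] at h
  rw [← sub_eq_iff_eq_add.2 h.symm]
  abel

/-- `ν Δu − ω × u = ∂ₜu + ∇(p + |u|²/2)` on `[0, T)` (momentum equation + Lamb identity). -/
theorem head_eq {ν T : ℝ} {u : ℝ → E3 → E3} {p : ℝ → E3 → ℝ} (hsol : IsClassicalNSSolutionOn (Ico 0 T) ν 0 u p)
    {t : ℝ} (ht : t ∈ Ico 0 T) (x : E3) :
    ν • (Δ (u t)) x - cross (curl (u t) x) (u t x) =
      timeDerivWithin (Ico 0 T) u t x + gradient (p t) x + gradient (fun y => ‖u t y‖ ^ 2 / 2) x := by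
  have hd : DifferentiableAt ℝ (u t) x :=
    (hsol.smooth_velocity.contDiff_slice ht).differentiable (by simp) x
  rw [← drive_eq hsol ht x, convect_self_eq_cross_curl_add_gradient hd]
  abel

/-- The dynamic and kinematic drive defects agree for classical solutions on `[0, T)`, `T > 0`. -/
theorem hasDriveDefectAt_iff {ν T ε : ℝ} (hT : 0 < T) {Λ : ℝ → ℝ} {u : ℝ → E3 → E3} {p : ℝ → E3 → ℝ}
    (hsol : IsClassicalNSSolutionOn (Ico 0 T) ν 0 u p) :
    HasDriveDefectAt T Λ ν ε u p ↔ HasEquilibriumDefectAt T Λ ν ε u := by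
  refine Filter.eventually_congr ?_
  filter_upwards [Ioo_mem_nhdsLT hT] with t ht
  refine forall_congr' fun x => ?_
  rw [drive_eq hsol (Ioo_subset_Ico_self ht) x]

/-- The dynamic and kinematic head defects agree for classical solutions on `[0, T)`, `T > 0`. -/
theorem hasHeadDefectAt_iff {ν T ε : ℝ} (hT : 0 < T) {Λ : ℝ → ℝ} {u : ℝ → E3 → E3} {p : ℝ → E3 → ℝ}
    (hsol : IsClassicalNSSolutionOn (Ico 0 T) ν 0 u p) :
    HasHeadDefectAt T Λ ν ε u p ↔ HasLambDefectAt T Λ ν ε u := by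
  refine Filter.eventually_congr ?_
  filter_upwards [Ioo_mem_nhdsLT hT] with t ht
  refine forall_congr' fun x => ?_
  rw [head_eq hsol (Ioo_subset_Ico_self ht) x]

/-! ### Read-outs of (value, gradient, Hessian) -/

/-- The coordinate unit vectors. -/
abbrev eI (i : Fin 3) : E3 := EuclideanSpace.single i (1 : ℝ)

/-- Trace read-out: `Σᵢ H eᵢ eᵢ` (the Laplacian, when `H = D²v(x)`). -/
def lapOf (H : Hess) : E3 := ∑ i, H (eI i) (eI i)

/-- Equilibrium read-out: `tr H − L v` (`= Δv − (v·∇)v` at `x` when `v = v(x)`, `L = Dv(x)`, `H = D²v(x)`). -/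
def eqOf (v : E3) (L : E3 →L[ℝ] E3) (H : Hess) : E3 := lapOf H - L v

/-- Lamb read-out: `tr H − (curlCLM L) × v` (`= Δv − ω × v`). -/
def lambOf (v : E3) (L : E3 →L[ℝ] E3) (H : Hess) : E3 := lapOf H - cross (curlCLM L) v

/-- `lapOf` is homogeneous. -/
theorem lapOf_smul (a : ℝ) (H : Hess) : lapOf (a • H) = a • lapOf H := by
  simp only [lapOf, _root_.smul_apply, Finset.smul_sum]

/-- `lapOf` is continuous. -/
theorem continuous_lapOf : Continuous lapOf := by
  unfold lapOf
  refine continuous_finsetSum _ fun i _ => ?_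
  exact ((ContinuousLinearMap.apply ℝ E3 (eI i)).continuous).comp
    ((ContinuousLinearMap.apply ℝ (E3 →L[ℝ] E3) (eI i)).continuous)

/-- `Δ v (x) = Σᵢ D²v(x) eᵢ eᵢ` (Mathlib's Laplacian on the standard orthonormal basis of `ℝ³`). -/
theorem laplacian_eq_lapOf (v : E3 → E3) (x : E3) : (Δ v) x = lapOf (fderiv ℝ (fderiv ℝ v) x) := by
  rw [InnerProductSpace.laplacian_eq_iteratedFDeriv_orthonormalBasis v (EuclideanSpace.basisFun (Fin 3) ℝ)]
  simp only [lapOf]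
  refine Finset.sum_congr rfl fun i _ => ?_
  rw [iteratedFDeriv_two_apply, EuclideanSpace.basisFun_apply]
  rfl

/-- `Δv − (v·∇)v` is the equilibrium read-out of `(v, ∇v, ∇²v)`. -/
theorem laplacian_sub_convect_eq_eqOf (v : E3 → E3) (x : E3) :
    (Δ v) x - convect v v x = eqOf (v x) (fderiv ℝ v x) (fderiv ℝ (fderiv ℝ v) x) := by
  rw [eqOf, laplacian_eq_lapOf]; rfl

/-- `Δv − ω × v` is the Lamb read-out of `(v, ∇v, ∇²v)`. -/
theorem laplacian_sub_lamb_eq_lambOf (v : E3 → E3) (x : E3) :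
    (Δ v) x - cross (curl v x) (v x) = lambOf (v x) (fderiv ℝ v x) (fderiv ℝ (fderiv ℝ v) x) := by
  rw [lambOf, laplacian_eq_lapOf, curl_eq_curlCLM]

/-- `eqOf` is homogeneous of weight 3 under the zoom scaling. -/
theorem eqOf_smul {a : ℝ} (v : E3) (L : E3 →L[ℝ] E3) (H : Hess) :
    eqOf (a • v) (a ^ 2 • L) (a ^ 3 • H) = a ^ 3 • eqOf v L H := by
  simp only [eqOf, lapOf_smul, _root_.smul_apply, ContinuousLinearMap.map_smul, smul_sub, smul_smul]
  ring_nf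

/-- `lambOf` is homogeneous of weight 3 under the zoom scaling. -/
theorem lambOf_smul {a : ℝ} (v : E3) (L : E3 →L[ℝ] E3) (H : Hess) :
    lambOf (a • v) (a ^ 2 • L) (a ^ 3 • H) = a ^ 3 • lambOf v L H := by
  simp only [lambOf, lapOf_smul, ContinuousLinearMap.map_smul, ← crossCLM_apply, _root_.smul_apply, smul_sub,
    smul_smul]
  ring_nf

/-- `eqOf` is continuous. -/
theorem continuous_eqOf : Continuous fun q : E3 × (E3 →L[ℝ] E3) × Hess => eqOf q.1 q.2.1 q.2.2 :=
  (continuous_lapOf.comp continuous_snd.snd).sub (continuous_snd.fst.clm_apply continuous_fst)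

/-- `lambOf` is continuous. -/
theorem continuous_lambOf : Continuous fun q : E3 × (E3 →L[ℝ] E3) × Hess => lambOf q.1 q.2.1 q.2.2 := by
  have hc : Continuous fun q : E3 × (E3 →L[ℝ] E3) × Hess => crossCLM (curlCLM q.2.1) q.1 :=
    ((crossCLM : E3 →L[ℝ] E3 →L[ℝ] E3).continuous.comp
      ((curlCLM : (E3 →L[ℝ] E3) →L[ℝ] E3).continuous.comp continuous_snd.fst)).clm_apply continuous_fst
  exact (continuous_lapOf.comp continuous_snd.snd).sub hc

/-- `ν`-normalisation of the equilibrium read-out: `ν clock₂ ‖eqOf(u/ν, ∇u/ν, ∇²u/ν)‖ = clock₂/ν ‖νΔu − (u·∇)u‖`. -/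
theorem nu_readout_eqOf {ν : ℝ} (hν : 0 < ν) (w : ℝ) (v : E3 → E3) (x : E3) :
    ν * w * ‖eqOf (ν⁻¹ • v x) (ν⁻¹ • fderiv ℝ v x) (ν⁻¹ • fderiv ℝ (fderiv ℝ v) x)‖ =
      w / ν * ‖ν • (Δ v) x - convect v v x‖ := by
  have e : eqOf (ν⁻¹ • v x) (ν⁻¹ • fderiv ℝ v x) (ν⁻¹ • fderiv ℝ (fderiv ℝ v) x) =
      (ν⁻¹ * ν⁻¹) • (ν • (Δ v) x - convect v v x) := by
    simp only [eqOf, lapOf_smul, _root_.smul_apply, ContinuousLinearMap.map_smul, smul_sub, smul_smul,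
      laplacian_eq_lapOf, convect]
    rw [show ν⁻¹ * ν⁻¹ * ν = ν⁻¹ by field_simp]
  rw [e, norm_smul, Real.norm_eq_abs, abs_of_pos (by positivity)]
  field_simp

/-- `ν`-normalisation of the Lamb read-out. -/
theorem nu_readout_lambOf {ν : ℝ} (hν : 0 < ν) (w : ℝ) (v : E3 → E3) (x : E3) :
    ν * w * ‖lambOf (ν⁻¹ • v x) (ν⁻¹ • fderiv ℝ v x) (ν⁻¹ • fderiv ℝ (fderiv ℝ v) x)‖ =
      w / ν * ‖ν • (Δ v) x - cross (curl v x) (v x)‖ := by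
  have e : lambOf (ν⁻¹ • v x) (ν⁻¹ • fderiv ℝ v x) (ν⁻¹ • fderiv ℝ (fderiv ℝ v) x) =
      (ν⁻¹ * ν⁻¹) • (ν • (Δ v) x - cross (curl v x) (v x)) := by
    simp only [lambOf, lapOf_smul, ContinuousLinearMap.map_smul, ← crossCLM_apply, _root_.smul_apply, smul_sub,
      smul_smul, laplacian_eq_lapOf, curl_eq_curlCLM]
    rw [show ν⁻¹ * ν⁻¹ * ν = ν⁻¹ by field_simp]
  rw [e, norm_smul, Real.norm_eq_abs, abs_of_pos (by positivity)]
  field_simp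

/-- The kinematic equilibrium defect is the joint defect of `‖eqOf‖`. -/
theorem hasEquilibriumDefectAt_iff_joint {T ν ε : ℝ} (hν : 0 < ν) {Λ : ℝ → ℝ} {u : ℝ → E3 → E3} :
    HasEquilibriumDefectAt T Λ ν ε u ↔ HasJointDefectAt T Λ ν ε (fun v L H => ‖eqOf v L H‖) u := by
  refine Filter.eventually_congr (Eventually.of_forall fun t => forall_congr' fun x => ?_)
  rw [nu_readout_eqOf hν]

/-- The kinematic Lamb defect is the joint defect of `‖lambOf‖`. -/
theorem hasLambDefectAt_iff_joint {T ν ε : ℝ} (hν : 0 < ν) {Λ : ℝ → ℝ} {u : ℝ → E3 → E3} :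
    HasLambDefectAt T Λ ν ε u ↔ HasJointDefectAt T Λ ν ε (fun v L H => ‖lambOf v L H‖) u := by
  refine Filter.eventually_congr (Eventually.of_forall fun t => forall_congr' fun x => ?_)
  rw [nu_readout_lambOf hν]

/-! ## §2 Second-order calculus of zooms and the `C²_loc` convergence tool -/

-- `fderiv_smul_stPull_apply`: the line restates the tree's `InviscidTop.fderiv_smul_stPull_apply`; taken BY NAME (gate lint dedup.landed).

-- `fderiv_smul_stPull`: the line restates the tree's `InviscidTop.fderiv_smul_stPull`; taken BY NAME (gate lint dedup.landed).

-- `fderiv_fderiv_smul_stPull`: the line restates the tree's `InviscidTop.fderiv_fderiv_smul_stPull`; taken BY NAME (gate lint dedup.landed).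

-- `fderiv_fderiv_zoom`: the line restates the tree's `InviscidTop.fderiv_fderiv_zoom`; taken BY NAME (gate lint dedup.landed).

-- `tendsto_clm_of_tendsto_apply`: the line restates the tree's `InviscidTop.tendsto_clm_of_tendsto_apply`; taken BY NAME (gate lint dedup.landed).

-- `tendsto_fderiv_fderiv_apply_of_bound`: the line restates the tree's `InviscidTop.tendsto_fderiv_fderiv_apply_of_bound`; taken BY NAME (gate lint dedup.landed).

-- `tendsto_fderiv_fderiv_of_bound`: the line restates the tree's `InviscidTop.tendsto_fderiv_fderiv_of_bound`; taken BY NAME (gate lint dedup.landed).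

/-! ### Hessian (`C²_loc`) convergence of Type-I mild sequences — the line's new extraction tool -/

-- `tendsto_fderiv_fderiv_of_typeI_seq_Ioo`: the line restates the tree's `InviscidTop.tendsto_fderiv_fderiv_of_typeI_seq_Ioo`; taken BY NAME (gate lint dedup.landed).

-- `tendsto_fderiv_fderiv_of_isTypeIAncientMild_seq`: the line restates the tree's `InviscidTop.tendsto_fderiv_fderiv_of_isTypeIAncientMild_seq`; taken BY NAME (gate lint dedup.landed).

end Summit.NavierStokesRegularity.NavierStokesRegularity.Theorems.ScenarioCensus.EquilibriumTop

end
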